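import Mathlib
import HarnessLib.Audit
import Summits.PneNP.PneNP.Theorems.PstarGateCasePNorJoins
import Summits.PneNP.PneNP.Theorems.PstarBridgeJoins
import Summits.PneNP.PneNP.Theorems.PstarNorCoreTools
import Summits.PneNP.PneNP.Theorems.PstarNorUnitBridge
import Summits.PneNP.PneNP.Theorems.PstarChordBridgeFundamental

/-!
# One GATED chord, node N1 (CASE P, all other chords (NOR)): the HOLDERS — every tree edge has an AND variable held twice (E2; prover-1 g18)

FRONTIER range-avoidance ladder, rung F-N3 (`stmt-PneNP-19007`), cell `pnp-ideate` (`PstarGateNodesX.GateCasePNorX`; this seat's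
`HOME/pnp-ideate-prover-1/g18/E2-PLAN-v3.md` §3); restricted-model proof complexity — nothing here bears on `P` versus `NP`.

The combinatorial input of the N1 boundary counts (`PstarGateCasePNorCount`).  CASE P with every other chord (NOR): by
`PstarGateCasePNorJoins.caseP_nor_structure`, the clean `nor_unit_of_dir` for each other chord with the cert-independent literal pair, and
`PstarBridgeJoins.mem_join_of_not_mem_fundamental`, every tree edge `t` holds one of `σ, τ, u` in an AND slot, and that variable is held by a
SECOND output among the four HOLDERS `j₁ ∋ σ`, `j₂ ∋ τ` (the CONS-T pair of the NOR chord), `g₀ ∋ u` (the gate) and `g ⊇ {σ, τ}` (the NOR realiser):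
`nor_holders`.  It also records that the AND slots of `g₀` are held by `e` and a tree edge, those of a gate realiser by `j₁, j₂`, and `g ≠ g₀`.
Small tools: `not_mem_bdry_of_closed`, `not_mem_bdry_sup`, `card_three_slots`.
-/

set_option linter.dupNamespace false -- `Summit.PneNP.PneNP.…`: summit = sub-problem name (D-0017 single-conjunct layout)

open Finset Module Literature.Computability.Complexity
open Summit.PneNP.PneNP.Theorems.PstarTyped (Typed)
open Summit.PneNP.PneNP.Theorems.PstarSALevel (varSet bdry BoundaryExpanding SimpleOverlap)
open Summit.PneNP.PneNP.Theorems.PstarGapLinearised (andPair andPair_subset_varSet)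
open Summit.PneNP.PneNP.Theorems.PstarGapPeeling (not_mem_varSet_of_private)
open Summit.PneNP.PneNP.Theorems.PstarChordEndgameTools (mem_andPair_iff)
open Summit.PneNP.PneNP.Theorems.PstarCentreFree (vars_mem_varSet)
open Summit.PneNP.PneNP.Theorems.PstarXCore (xverts)
open Summit.PneNP.PneNP.Theorems.PstarCoreBound (XorClosed)
open Summit.PneNP.PneNP.Theorems.PstarReadSumset (V2)
open Summit.PneNP.PneNP.Theorems.PstarChordSystem (ChordSystem)
open Summit.PneNP.PneNP.Theorems.PstarChordBridgeTools (privs coef)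
open Summit.PneNP.PneNP.Theorems.PstarChordBridge (BridgeData sys Solution Lift)
open Summit.PneNP.PneNP.Theorems.PstarChordBridgeCotree (Peelable)
open Summit.PneNP.PneNP.Theorems.PstarChordBridgeForcing (gam freeMon)
open Summit.PneNP.PneNP.Theorems.PstarChordBridgeBasis (qDir polarDir)
open Summit.PneNP.PneNP.Theorems.PstarNorUnitDir (nor_unit_of_dir lit_iff_of_dir)
open Summit.PneNP.PneNP.Theorems.PstarNorCoreTools (not_mem_bdry_of_two card_varSet_inter_bdry_le card_bdry_le_sum)
open Summit.PneNP.PneNP.Theorems.PstarNorUnitBridge (xor_not_mem_bdry_of_even)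
open Summit.PneNP.PneNP.Theorems.PstarGateBridge (GateHyp)
open Summit.PneNP.PneNP.Theorems.PstarGateCasePRegimes (NorCert)
open Summit.PneNP.PneNP.Theorems.PstarGateNodes (GateData ReadAlong AllRead)
open Summit.PneNP.PneNP.Theorems.PstarGateNodesX (GateDataX)
open Summit.PneNP.PneNP.Theorems.PstarGateCasePNorJoins (caseP_nor_structure)
open Summit.PneNP.PneNP.Theorems.PstarBridgeJoins (mem_join_of_not_mem_fundamental)

namespace Summit.PneNP.PneNP.Theorems.PstarGateCasePNorHolders

variable {n m : ℕ}

/-- An inner XOR variable of an XOR-closed core stays inner in any superset. -/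
theorem not_mem_bdry_of_closed (I : LocalMap 4 n m) {J₀ X : Finset (Fin m)} (hX : XorClosed I J₀) (hJX : J₀ ⊆ X) {f : Fin m} (hf : f ∈ J₀)
    {s : Fin 4} (hs : s.val < 2) : I.vars f s ∉ bdry I X := by
  classical
  have h := hX f hf s hs
  unfold PstarSALevel.bdry at h
  rw [mem_filter, not_and] at h
  have hne1 := h (mem_univ _)
  have hf' : f ∈ J₀.filter (fun j => I.vars f s ∈ varSet I j) := mem_filter.2 ⟨hf, vars_mem_varSet I f s⟩
  have h2 : 1 < (J₀.filter (fun j => I.vars f s ∈ varSet I j)).card := by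
    have := card_pos.2 ⟨f, hf'⟩; omega
  obtain ⟨a, ha, b, hb, hab⟩ := one_lt_card.1 h2
  exact not_mem_bdry_of_two I (hJX (mem_filter.1 ha).1) (hJX (mem_filter.1 hb).1) hab (mem_filter.1 ha).2 (mem_filter.1 hb).2

/-- An inner variable of a sub-family stays inner in any superset. -/
theorem not_mem_bdry_sup (I : LocalMap 4 n m) {E X : Finset (Fin m)} (hEX : E ⊆ X) {f : Fin m} (hf : f ∈ E) {v : Fin n} (hv : v ∈ varSet I f)
    (h : v ∉ bdry I E) : v ∉ bdry I X := by
  classical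
  unfold PstarSALevel.bdry at h
  rw [mem_filter, not_and] at h
  have hne1 := h (mem_univ _)
  have hf' : f ∈ E.filter (fun j => v ∈ varSet I j) := mem_filter.2 ⟨hf, hv⟩
  have h2 : 1 < (E.filter (fun j => v ∈ varSet I j)).card := by
    have := card_pos.2 ⟨f, hf'⟩; omega
  obtain ⟨a, ha, b, hb, hab⟩ := one_lt_card.1 h2
  exact not_mem_bdry_of_two I (hEX (mem_filter.1 ha).1) (hEX (mem_filter.1 hb).1) hab (mem_filter.1 ha).2 (mem_filter.1 hb).2

/-- Three distinct slots. -/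
theorem card_three_slots {s : Fin 4} (hs : 2 ≤ s.val) : ({0, 1, s} : Finset (Fin 4)).card = 3 := by
  rw [card_insert_of_notMem, card_pair]
  · intro h; rw [← h] at hs; simp at hs
  · rw [mem_insert, mem_singleton]; push Not
    exact ⟨by decide, fun h => by rw [← h] at hs; simp at hs⟩

/-- **The holders.**  See the module docstring. -/
theorem nor_holders (I : LocalMap 4 n m) (hI : I.IsPure xorAndPred) (hT : Typed I) (hS : SimpleOverlap I) {r : ℕ}
    (hB : BoundaryExpanding r I) {B : BridgeData n m} {e g₀ : Fin m} {u : Fin n} {κ₀ : ZMod 2} (hD : GateDataX I r B e g₀ u κ₀)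
    (hRA : ReadAlong I B e (1, 0)) (hread : AllRead I B e) (hNOR : ∀ e' ∈ B.N, e' ≠ e → NorCert I B (B.D e') (gam B e'))
    (hne : (B.N.erase e).Nonempty) :
    ∃ j₁ j₂ g : Fin m, ∃ σ τ : Fin n, j₁ ∈ B.J₀ \ B.N ∧ j₂ ∈ B.J₀ \ B.N ∧ j₁ ≠ j₂ ∧ σ ≠ τ ∧ σ ∈ andPair I j₁ ∧ τ ∈ andPair I j₂ ∧
      g ∈ B.T₁ ∪ freeMon I B.N B.G₁ ∪ (B.T₂ ∪ freeMon I B.N B.G₂) ∧ σ ∈ andPair I g ∧ τ ∈ andPair I g ∧ g ≠ g₀ ∧ g ∈ B.J₀ ∪ B.G₁ ∪ B.G₂ ∧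
      (∀ t ∈ B.J₀ \ B.N, ∃ s : Fin 4, 2 ≤ s.val ∧ ∃ k ∈ ({j₁, j₂, g₀, g} : Finset (Fin m)), k ≠ t ∧ I.vars t s ∈ varSet I k) ∧
      (∀ s : Fin 4, 2 ≤ s.val → ∃ k ∈ insert e (B.J₀ \ B.N), k ≠ g₀ ∧ I.vars g₀ s ∈ varSet I k) ∧
      (g ∉ B.J₀ → ∀ s : Fin 4, 2 ≤ s.val → ∃ k ∈ ({j₁, j₂} : Finset (Fin m)), k ≠ g ∧ I.vars g s ∈ varSet I k) := by
  classical
  obtain ⟨hXc, hW, hr, hd₁, hd₂, hL, hPe, -, hG, hg₀, hgv, hju, -, -, -, hcoef, hT3, hM0⟩ := id hD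
  have he : e ∈ B.N := hG.1
  have heJ : e ∈ B.J₀ := hW.hN he
  have hg₀J : g₀ ∉ B.J₀ := fun h => disjoint_left.1 hd₁ hg₀ h
  obtain ⟨e', he'⟩ := hne
  obtain ⟨hne', he'N⟩ := mem_erase.1 he'
  obtain ⟨j₁, j₂, σ, τ, hne12, hDe', hdisj, hσ, hτ, ⟨g, hg, hσg, hτg⟩, hlit, hDe, hT₂, hT₁⟩ :=
    caseP_nor_structure I hI hT hS hB hD hRA hread he'N (hNOR e' he'N hne')
  set T := B.J₀ \ B.N with hTdef
  have hj₁T : j₁ ∈ T := hW.hD e' he'N (by rw [hDe']; simp)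
  have hj₂T : j₂ ∈ T := hW.hD e' he'N (by rw [hDe']; simp)
  have hTJ : T ⊆ B.J₀ := sdiff_subset
  have hστ : σ ≠ τ := fun h => disjoint_left.1 hdisj hσ (h ▸ hτ)
  -- `g`'s membership in the radius
  have hgR : g ∈ B.J₀ ∪ B.G₁ ∪ B.G₂ := by
    rcases mem_union.1 hg with hg | hg <;> rcases mem_union.1 hg with hg | hg
    · exact mem_union_left _ (mem_union_left _ (mem_sdiff.1 (hW.hT₁ hg)).1)
    · exact mem_union_left _ (mem_union_right _ (mem_filter.1 hg).1)
    · exact mem_union_left _ (mem_union_left _ (mem_sdiff.1 (hW.hT₂ hg)).1)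
    · exact mem_union_right _ (mem_filter.1 hg).1
  -- `g ≠ g₀`: the gate's AND pair holds the private `p`, the realiser's is `{σ, τ}` on tree edges
  have hpσ : I.vars e 2 ≠ σ := fun h =>
    not_mem_varSet_of_private I heJ (hTJ hj₁T) (fun h' => (mem_sdiff.1 hj₁T).2 (h' ▸ he)) (hW.hchord e he).1 (vars_mem_varSet I e 2)
      (h ▸ andPair_subset_varSet I j₁ hσ)
  have hpτ : I.vars e 2 ≠ τ := fun h =>
    not_mem_varSet_of_private I heJ (hTJ hj₂T) (fun h' => (mem_sdiff.1 hj₂T).2 (h' ▸ he)) (hW.hchord e he).2 |> fun _ =>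
      not_mem_varSet_of_private I heJ (hTJ hj₂T) (fun h' => (mem_sdiff.1 hj₂T).2 (h' ▸ he)) (hW.hchord e he).1 (vars_mem_varSet I e 2)
        (h ▸ andPair_subset_varSet I j₂ hτ)
  have hgg₀ : g ≠ g₀ := by
    intro h
    rw [h] at hσg hτg
    rcases (mem_andPair_iff I g₀ σ).1 hσg with h1 | h1 <;> rcases (mem_andPair_iff I g₀ τ).1 hτg with h2 | h2
    · exact hστ (h1.trans h2.symm)
    · rcases hgv with ⟨hp, -⟩ | ⟨-, hp⟩
      · exact hpσ (hp ▸ h1).symm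
      · exact hpτ (hp ▸ h2).symm
    · rcases hgv with ⟨hp, -⟩ | ⟨-, hp⟩
      · exact hpτ (hp ▸ h2).symm
      · exact hpσ (hp ▸ h1).symm
    · exact hστ (h1.trans h2.symm)
  -- holders: `u` by `g₀`, `σ` by `j₁`/`g`, `τ` by `j₂`/`g`
  have hu_g₀ : u ∈ varSet I g₀ := by
    rcases hgv with ⟨-, h3⟩ | ⟨h2, -⟩
    · exact h3 ▸ vars_mem_varSet I g₀ 3
    · exact h2 ▸ vars_mem_varSet I g₀ 2
  -- the other chords' fundamental pairs hold `σ` or `τ`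
  have hothers : ∀ e'' ∈ B.N, e'' ≠ e → ∀ j ∈ B.D e'', ∃ s : Fin 4, 2 ≤ s.val ∧ (I.vars j s = σ ∨ I.vars j s = τ) := by
    intro e'' he'' hne'' j hj
    have he''G : e'' ∉ B.G₁ ∪ B.G₂ := by
      intro h
      rcases mem_union.1 h with h | h
      · exact disjoint_left.1 hd₁ h (hW.hN he'')
      · exact disjoint_left.1 hd₂ h (hW.hN he'')
    obtain ⟨a, b, hab, hq, m₁, m₂, hm₁, hm₂, hQ⟩ := hNOR e'' he'' hne''
    obtain ⟨k₁, k₂, σ', τ', -, hDk, -, hσ', hτ', hlit', -⟩ := nor_unit_of_dir I hI hS hB hW hr he'' he''G (1, 0) hq hm₁ hm₂ hQ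
    have hmem : ∀ v, (v = σ' ∨ v = τ') → (v = σ ∨ v = τ) := fun v hv =>
      (hlit v).1 ((lit_iff_of_dir I B (1, 0) hab hq v).1 ((hlit' v).2 hv))
    rw [hDk, mem_insert, mem_singleton] at hj
    rcases hj with rfl | rfl
    · rcases (mem_andPair_iff I _ σ').1 hσ' with h | h
      · exact ⟨2, by decide, hmem _ (Or.inl h.symm)⟩
      · exact ⟨3, by decide, hmem _ (Or.inl h.symm)⟩
    · rcases (mem_andPair_iff I _ τ').1 hτ' with h | h
      · exact ⟨2, by decide, hmem _ (Or.inr h.symm)⟩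
      · exact ⟨3, by decide, hmem _ (Or.inr h.symm)⟩
  -- every tree edge holds one of `σ, τ, u` in an AND slot
  have htree : ∀ t ∈ T, ∃ s : Fin 4, 2 ≤ s.val ∧ (I.vars t s = σ ∨ I.vars t s = τ ∨ I.vars t s = u) := by
    intro t ht
    have h3 : ∀ {v : Fin n}, v ∈ ({σ, τ, u} : Finset (Fin n)) → v = σ ∨ v = τ ∨ v = u := by
      intro v hv; simpa only [mem_insert, mem_singleton] using hv
    rcases mem_join_of_not_mem_fundamental I hI hT hW hPe hT3 ht (hM0 t (hTJ ht)) with ⟨e'', he'', htD⟩ | htT | htT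
    · by_cases hee : e'' = e
      · subst hee
        rcases hDe t htD with h | h
        · exact ⟨2, by decide, h3 h⟩
        · exact ⟨3, by decide, h3 h⟩
      · obtain ⟨s, hs, h⟩ := hothers e'' he'' hee t htD
        exact ⟨s, hs, by rcases h with h | h <;> simp [h]⟩
    · rcases hT₁ t (mem_union_left _ htT) with h | h
      · exact ⟨2, by decide, h3 h⟩
      · exact ⟨3, by decide, h3 h⟩
    · exact ⟨2, by decide, by rcases (hT₂ t htT).1 with h | h <;> simp [h]⟩
  -- a second holder in `X` for that variable
  set H : Finset (Fin m) := {j₁, j₂, g₀, g} with hHdef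
  have hj₁H : j₁ ∈ H := by simp [hHdef]
  have hj₂H : j₂ ∈ H := by simp [hHdef]
  have hg₀H : g₀ ∈ H := by simp [hHdef]
  have hgH : g ∈ H := by simp [hHdef]
  have hholder : ∀ t ∈ T, ∃ s : Fin 4, 2 ≤ s.val ∧ ∃ k ∈ H, k ≠ t ∧ I.vars t s ∈ varSet I k := by
    intro t ht
    have htJ : t ∈ B.J₀ := hTJ ht
    obtain ⟨s, hs, hv⟩ := htree t ht
    -- generic holders
    have holdσ : t ≠ j₁ → ∀ {s' : Fin 4}, I.vars t s' = σ → ∃ k ∈ H, k ≠ t ∧ I.vars t s' ∈ varSet I k :=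
      fun hne s' h => ⟨j₁, hj₁H, fun h' => hne h'.symm, h ▸ andPair_subset_varSet I j₁ hσ⟩
    have holdτ : t ≠ j₂ → ∀ {s' : Fin 4}, I.vars t s' = τ → ∃ k ∈ H, k ≠ t ∧ I.vars t s' ∈ varSet I k :=
      fun hne s' h => ⟨j₂, hj₂H, fun h' => hne h'.symm, h ▸ andPair_subset_varSet I j₂ hτ⟩
    have holdg : t ≠ g → ∀ {s' : Fin 4}, (I.vars t s' = σ ∨ I.vars t s' = τ) → ∃ k ∈ H, k ≠ t ∧ I.vars t s' ∈ varSet I k :=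
      fun hne s' h => ⟨g, hgH, fun h' => hne h'.symm, by
        rcases h with h | h
        · exact h ▸ andPair_subset_varSet I g hσg
        · exact h ▸ andPair_subset_varSet I g hτg⟩
    rcases hv with hv | hv | hv
    · -- `σ`
      by_cases htj : t = j₁
      · by_cases htg : t = g
        · -- `t = j₁ = g` holds `τ` too: use the `τ` slot with `j₂`
          have hτt : τ ∈ andPair I t := htg ▸ hτg
          rcases (mem_andPair_iff I t τ).1 hτt with h | h
          · exact ⟨2, by decide, holdτ (fun h' => hne12 (htj.symm.trans h')) h.symm⟩
          · exact ⟨3, by decide, holdτ (fun h' => hne12 (htj.symm.trans h')) h.symm⟩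
        · exact ⟨s, hs, holdg htg (Or.inl hv)⟩
      · exact ⟨s, hs, holdσ htj hv⟩
    · -- `τ`
      by_cases htj : t = j₂
      · by_cases htg : t = g
        · have hσt : σ ∈ andPair I t := htg ▸ hσg
          rcases (mem_andPair_iff I t σ).1 hσt with h | h
          · exact ⟨2, by decide, holdσ (fun h' => hne12 (h'.symm.trans htj)) h.symm⟩
          · exact ⟨3, by decide, holdσ (fun h' => hne12 (h'.symm.trans htj)) h.symm⟩
        · exact ⟨s, hs, holdg htg (Or.inr hv)⟩
      · exact ⟨s, hs, holdτ htj hv⟩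
    · -- `u`
      exact ⟨s, hs, g₀, hg₀H, fun h => hg₀J (h ▸ htJ), hv ▸ hu_g₀⟩
  -- per-output budgets

  -- the AND slots of `g₀` and of a gate realiser
  have hs23 : ∀ s' : Fin 4, 2 ≤ s'.val → s' = 2 ∨ s' = 3 := by
    intro s' hs'
    rcases s' with ⟨s', h4⟩
    simp only [Fin.ext_iff]
    simp only at hs'
    omega
  have hg₀slots : ∀ s : Fin 4, 2 ≤ s.val → ∃ k ∈ insert e (B.J₀ \ B.N), k ≠ g₀ ∧ I.vars g₀ s ∈ varSet I k := by
    intro s' hs'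
    obtain ⟨j₀, hj₀, hju'⟩ := hju
    have hj₀ne : j₀ ≠ g₀ := fun h => hg₀J (h ▸ (mem_sdiff.1 hj₀).1)
    have hu_j₀ : u ∈ varSet I j₀ := by rcases hju' with h | h <;> rw [h] <;> exact vars_mem_varSet I j₀ _
    have hp_e : I.vars e 2 ∈ varSet I e := vars_mem_varSet I e 2
    have hene : e ≠ g₀ := fun h => hg₀J (h ▸ heJ)
    rcases hs23 s' hs' with rfl | rfl
    · rcases hgv with ⟨h2, -⟩ | ⟨h2, -⟩
      · exact ⟨e, mem_insert_self _ _, hene, h2 ▸ hp_e⟩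
      · exact ⟨j₀, mem_insert_of_mem hj₀, hj₀ne, h2 ▸ hu_j₀⟩
    · rcases hgv with ⟨-, h3⟩ | ⟨-, h3⟩
      · exact ⟨j₀, mem_insert_of_mem hj₀, hj₀ne, h3 ▸ hu_j₀⟩
      · exact ⟨e, mem_insert_self _ _, hene, h3 ▸ hp_e⟩
  have hgslots : g ∉ B.J₀ → ∀ s : Fin 4, 2 ≤ s.val → ∃ k ∈ ({j₁, j₂} : Finset (Fin m)), k ≠ g ∧ I.vars g s ∈ varSet I k := by
    intro hgJ s' hs'
    have hj₁ne : j₁ ≠ g := fun h => hgJ (h ▸ hTJ hj₁T)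
    have hj₂ne : j₂ ≠ g := fun h => hgJ (h ▸ hTJ hj₂T)
    have hslot : I.vars g s' = σ ∨ I.vars g s' = τ := by
      rcases (mem_andPair_iff I g σ).1 hσg with h1 | h1 <;> rcases (mem_andPair_iff I g τ).1 hτg with h2 | h2
      · exact absurd (h1.trans h2.symm) hστ
      · rcases hs23 s' hs' with rfl | rfl
        · exact Or.inl h1.symm
        · exact Or.inr h2.symm
      · rcases hs23 s' hs' with rfl | rfl
        · exact Or.inr h2.symm
        · exact Or.inl h1.symm
      · exact absurd (h1.trans h2.symm) hστ
    rcases hslot with h | h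
    · exact ⟨j₁, by simp, hj₁ne, h ▸ andPair_subset_varSet I j₁ hσ⟩
    · exact ⟨j₂, by simp, hj₂ne, h ▸ andPair_subset_varSet I j₂ hτ⟩
  exact ⟨j₁, j₂, g, σ, τ, hj₁T, hj₂T, hne12, hστ, hσ, hτ, hg, hσg, hτg, hgg₀, hgR, hholder, hg₀slots, hgslots⟩

end Summit.PneNP.PneNP.Theorems.PstarGateCasePNorHolders
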